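import Summits.Langlands.Langlands.Theses.SkinnerWilesDefectOne

/-!
# Disproof workfile for crux `ReducibleOrdinaryProModular` (item stmt-Langlands-12919) — findings

Standing adversary (cdisprove) on the ENGINE crux of route `SkinnerWilesDefectOne`:
`Summit.Langlands.Langlands.Theses.SkinnerWilesDefectOne.ReducibleOrdinaryProModular`
("an irreducible, a.e.-unramified `ρ : Γ_F → GL₂(ℚ̄_p)` over an imaginary quadratic `F`, residually
upper triangular in an integral frame, `p`-distinguished and SW-oriented ordinary of one parallel
weight at every `v ∣ p`, is `p`-adically automorphic of SOME tame level `𝒰`").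

## Verdict after cycle 1: NO KILL.  Why it resists

* The statement ELABORATES (probe `crux_unfold` below is `Iff.rfl`-level; rc 0) and has no junk
  operator: no division, the only `ℕ`-subtraction is `k - 1` under `2 ≤ k`, `bad` is finite by the
  `TameLevel` axioms (no "declare everything bad" escape), the big Hecke algebra `𝕋(𝒰)` is a genuine
  construction with `H⁰ ≠ 0` (so `ℤ_p ⊆ 𝕋(𝒰)`, no zero-ring escape), and the orientation inequality
  `‖Q₀₀‖ ≤ ‖Q₁₀‖` is the Skinner–Wiles transversality (checked on `T₅(11a1)`: global sub = trivial
  character, ordinary line ↦ `μ₅`-line = global quotient `ω`).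
* The conclusion `∃ 𝒰, 𝒰.IsPadicallyAutomorphic ρ` (unfolded in `isPadicallyAutomorphic_iff`) is the
  WEAK notion "associated with a continuous `ℚ̄_p`-point of the completed-cohomology Hecke algebra
  at some tame level, depth at bad places free".  By `crux_of_proModularity` below the crux is a
  formal consequence of the pro-modularity expectation `ProModularityGL2` ("every continuous
  irreducible a.e.-unramified `ρ : Γ_F → GL₂(ℚ̄_p)` is `p`-adically automorphic of some tame level"),
  which is the `GL₂`/imaginary-quadratic case of the big `R = 𝕋` / completed-cohomology conjectures
  (Emerton's ICM 2014 heuristics; Gee–Newton, *Patching and the completed homology of locally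
  symmetric spaces*, J. Inst. Math. Jussieu 21 (2022) 395–458, doi:10.1017/s1474748020000158 =
  arXiv:1609.06965, Theorem 2 / Prop. "big R = 𝕋": conditionally `R ≅ 𝕋^S(U^p)_𝔪`, local complete
  intersections of Krull dimension `1 + dim B − l₀`; here `dim R_S = 1 + h¹ − h² = 6 = 1 + 6 − 1`;
  Hansen, *Universal eigenvarieties, trianguline Galois representations…*, Crelle 730 (2017), §1.2,
  for the finite-slope shadow).
  A counterexample to the crux is therefore a counterexample to that conjecture: out of reach of
  cheap attacks, and no candidate family is known (Calegari–Mazur rigidity of ordinary families over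
  imaginary quadratic fields concerns CLASSICALITY, i.e. the exit crux, not pro-modularity).

## Load-bearing analysis (hypothesis by hypothesis)

| hypothesis dropped | status of the weakened statement | Lean content here |
|---|---|---|
| `hirr` (irreducible) | still inside `ProModularityGL2`-type expectations: sums of characters are Eisenstein points (`1 ⊕ ε ↔ T_{v,1} ↦ q_v+1` lives in `H⁰`) | none provable |
| `IsPDistinguishedAt`, orientation, ordinarity, `k ≥ 2`, `p ≠ 2`, integral model | surplus relative to `ProModularityGL2` (`crux_of_proModularity`) — load-bearing for the METHOD (Skinner–Wiles), not for truth | `crux_of_proModularity` |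
| `hunr` (a.e. unramified) | NECESSARY: the conclusion implies it (`ae_isUnramifiedAt_of_isPadicallyAutomorphic`); `withoutAEUnramified_iff` shows the drop is equivalent to crux ∧ "every admissible ρ is a.e. unramified", the latter expected false (infinitely ramified `p`-adic representations: Ramakrishna, Ann. of Math. 151 (2000) 793–815, doi:10.2307/121048; Khare–Larsen–Ramakrishna, Amer. J. Math. 127 (2005), doi:10.1353/ajm.2005.0026; a reducible-residual ordinary analogue restricted from `ℚ` to `F` would be the witness — not in print verbatim, not constructible here) | proved |

## Refuted / bounded natural strengthenings

* `not_isPadicallyAutomorphic_full`: the level CANNOT be fixed to `TameLevel.full` (bad = `{v ∣ p}`)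
  for any `ρ` ramified at some `v ∤ p` — e.g. the route's own witness `T₅(11a1)|Γ_{ℚ(√-2)}`
  (unipotent at `v ∣ 11`).  So `∃ 𝒰` with free `bad` AND free depth is essential
  (`bad_of_not_isUnramifiedAt`: `bad ⊇` ramification set).
* Orientation clause: non-vacuous (`exists_orientedFrame`, the swap frame) and genuinely
  restrictive (`not_oriented_of_lowerLeft_eq_zero`: every frame with `Q₁₀ = 0`, in particular
  `Q = 1` and all upper-triangular frames, violates it; `oriented_lowerLeft_ne_zero`).  The aligned
  orientation (ordinary line = global sub-line `e₀`, the "mixed type" of the route text) is OUTSIDE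
  the crux, as the planner intended.

* `isPadicallyAutomorphic_enlargeBad` / `exists_isPadicallyAutomorphic_bad_eq` (§7): the conclusion is
  upward closed in `bad`; with §2, WLOG `bad` = any finite set ⊇ ramification ∪ `{v ∣ p}` — the shape
  of `bad` carries no information either way.

## Mechanism probe (not bearing on truth): residual Selmer dimensions at the 11a witness
kit job `j008702` = `selmer-dims-SWD1b` (PARI/GP 2.15.4, script `selmer_dims.gp` in the refuter folder;
ran 2026-08-16T05:15Z, 0.3 s, exit 0; all five `bnfcertify = 1`, i.e. UNCONDITIONAL).  For
`F = ℚ(√d)`, `p = 5`, `S = {v ∣ 5} ∪ {v ∣ 11}` (bad set of the 11a isogeny class over `F`, plus `p`),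
`L = F(ζ₅)`, `ω(g₀) = 2`:  `a_i = dim_{𝔽₅} H¹(G_{F,S}, 𝔽₅(ωⁱ))` (= `ωⁱ`-part of `Cl_{25·11}(L)/5`) and
`b_i =` its subspace of classes unramified at every `v ∣ 5` (= `ωⁱ`-part of `Cl_{11}(L)/5`; for
`i ≠ 0` this IS "locally trivial at `v ∣ 5`" = Skinner–Wiles ADMISSIBLE, the Frobenius at the unique
prime of `L` over each `v ∣ 5` being `Gal(L/F)`-invariant).  Each entry `[from ℚ, new over F]`
(`τ = ±1` parts, `τ : √d ↦ −√d`); the SW cocycle of `ρ̄ = (1 ∗; 0 ω)` (11a3 lattice: sub `1`,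
quotient `ω`) lives in `i = 3` (`Ext¹(ω, 1) = H¹(𝔽₅(ω⁻¹))`).

| `d` | `a₀ a₁ a₂ a₃` (totals) | `b₀ b₁ b₂ b₃` (totals) | `a₃` split | `b₃` split | `b₁` split | `b₂` split |
|---|---|---|---|---|---|---|
| −1  | 3 3 2 2 | 1 0 0 1 | [2,0] | [1,0] | [0,0] | [0,0] |
| −2  | 4 3 3 3 | 2 1 1 1 | [2,1] | [1,0] | [0,1] | [0,1] |
| −3  | 3 2 2 2 | 1 0 0 1 | [2,0] | [1,0] | [0,0] | [0,0] |
| −7  | 4 3 3 3 | 2 0 1 1 | [2,1] | [1,0] | [0,0] | [0,1] |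
| −11 | 3 3 2 2 | 1 0 0 1 | [2,0] | [1,0] | [0,0] | [0,0] |

Sanity (predicted before the run): over `ℚ`, `a₃ = h¹(G_{ℚ,{5,11}}, ω⁻¹) = 1 + h² = 2` and
`b₃ = 1` (the 11a3 extension class itself); `a₀ = 2 + #{v ∣ 11 in F} ∈ {3, 4}`; `b₀ = 5`-rank of
the ray class group of `F` mod `11` — all as printed.
**Reading for the provers.** `b₃ = 1` for all five fields, ENTIRELY from `ℚ`: at the tangent level
the admissible (split-at-5) extension class of `(1, ω)` over `F` is UNIQUE — the planner's feared
"second split Selmer class" does not occur for the 11a witness at `p = 5` over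
`ℚ(i), ℚ(√-2), ℚ(√-3), ℚ(√-7), ℚ(√-11)` (Berger–Klosin-type residual uniqueness holds there).  New
over `F`: one class in `i = 1` (`d = −2`, the route's witness field: an `ω`-twisted class unramified
at 5, i.e. a lower-left tangent direction, not in the reducible locus) and one in `i = 2`
(`d = −2, −7`; `ω²` is the dual-Selmer / `Ш²(ω⁻¹)` character).  What this does NOT decide: the
Λ-adic dimension of the reducible locus of `R_𝒟` (needs the `μ`/`λ`-invariants of the
`ℤ₅²`-Iwasawa module, not a residual count) — so it neither kills nor proves the engine's Z3 step;
it only removes the cheapest residual obstruction for these targets.  Full stdout: evidence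
`RESULTS-selmer-dims-j008702.md` on item stmt-Langlands-12919 (and `~/compute/j008702/stdout.log`).

## Negative results in print: none found
zbMATH (2026-08-16): no counterexample literature for pro-modularity over imaginary quadratic
fields; Calegari–Mazur (J. Inst. Math. Jussieu 8 (2009), doi:10.1017/s1474748008000327, Conj. 1.3,
Cor. 1.4) is a RIGIDITY statement about infinitesimally classical (parallel-weight) nearly ordinary
deformations — it constrains classical points (the exit crux `ProModularOrdinaryClassical`), not
`p`-adic automorphy.  Skinner–Wiles' own "pro-modular" (Publ. IHÉS 89, §4.1, p. 61 of the pdf) is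
ORDINARY pro-modularity (primes of Hida's `𝕋_∞`), STRONGER than this crux's conclusion; the route
deliberately moved the ordinary factorisation into the exit crux.

## Landed through the gate (importable; prefer these over this workfile)
* p73497 ACCEPTED 2026-08-16: `Summits.Langlands.Langlands.Theorems.ReducibleOrdinaryProModular.Negative.LevelAndRamification`
  (namespace `Summit.Langlands.Langlands.Theorems.ReducibleOrdinaryProModular.Negative`):
  `isPadicallyAutomorphic_iff`, `heckeFrobPoly_two`, `bad_of_not_isUnramifiedAt`,
  `ae_isUnramifiedAt_of_isPadicallyAutomorphic`, `not_isPadicallyAutomorphic_full`,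
  `exists_isPadicallyAutomorphic_bad_eq` (= §§1–3, 7 below, def-free form).

## Targets
None yet (payload `stuck_stubs = []`, no line picked).  On re-arm: read this file, extend §Targets.

## Near-misses
None claimed.  No `sorry` in this file.
-/

set_option linter.dupNamespace false

namespace Summit.Langlands.Langlands.Cruxes.ReducibleOrdinaryProModular.Disproof

open Summit.Langlands.Langlands.Theses.SkinnerWilesDefectOne
open Literature.NumberTheory.GaloisRepresentations
open Literature.NumberTheory.Automorphic
open Literature.NumberTheory.Automorphic.BigHeckeGLn
open IsDedekindDomain Filter Polynomial
open scoped NumberField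

noncomputable section

/-! ### §0 Probe: the crux, verbatim (elaboration check; `Iff.rfl`) -/

/-- The crux restated binder by binder (elaborates; definitional). [probe] -/
theorem crux_unfold :
    ReducibleOrdinaryProModular ↔
      ∀ (F : Type) [Field F] [NumberField F], NumberField.IsTotallyComplex F →
        Module.finrank ℚ F = 2 → ∀ (p : ℕ) [Fact p.Prime], p ≠ 2 →
        ∀ (O : ValuationSubring (PadicAlgCl p)),
          O = (Valued.v : Valuation (PadicAlgCl p) NNReal).valuationSubring →
        ∀ (ρ : FramedGaloisRep F (PadicAlgCl p) 2)
          (ρ₀ : Field.absoluteGaloisGroup F →* Matrix.GeneralLinearGroup (Fin 2) O),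
          ρ.toGaloisRep.IsIrreducible → (∀ᶠ v in cofinite, ρ.IsUnramifiedAt v) →
          ρ.HasUpperTriangularIntegralModel ρ₀ →
          (∃ k : ℕ, 2 ≤ k ∧ ∃ m : ℕ, 0 < m ∧
            ∀ v : HeightOneSpectrum (𝓞 F), (p : 𝓞 F) ∈ v.asIdeal →
              IsPDistinguishedAt ρ₀ v ∧
              ∃ Q : Matrix.GeneralLinearGroup (Fin 2) (PadicAlgCl p),
                Valued.v (Q.val 0 0) ≤ Valued.v (Q.val 1 0) ∧
                ∀ σ, (Q⁻¹ * ρ.toLocal v σ * Q).val 1 0 = 0 ∧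
                  (σ ∈ absInertia (v.adicCompletion F) →
                    (Q⁻¹ * ρ.toLocal v σ * Q).val 1 1 ^ m = 1 ∧
                    (Q⁻¹ * ρ.toLocal v σ * Q).val 0 0 ^ m =
                      algebraMap (Padic p) (PadicAlgCl p)
                        (((GaloisRep.cyclotomicCharacter (v.adicCompletion F) p σ).val :
                          PadicInt p) : Padic p) ^ ((k - 1) * m))) →
          ∃ 𝒰 : TameLevel 2 F p, 𝒰.IsPadicallyAutomorphic ρ :=
  Iff.rfl

/-! ### §1 The conclusion, unfolded -/

section Conclusion

variable {n : ℕ} {F : Type} [Field F] [NumberField F] {p : ℕ} [Fact p.Prime]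
variable {A : Type*} [CommRing A] [TopologicalSpace A]

/-- `𝒰.IsPadicallyAutomorphic ρ` unfolded to the atoms the provers must produce: a CONTINUOUS ring
homomorphism `x : 𝕋(𝒰) → A` with, for every good place `v ∉ 𝒰.bad`, `ρ` unramified at `v` and
`charpoly ρ(Frob_v) = heckeFrobPoly n q_v (x ∘ T_{v,·})` (arithmetic Frobenius). [probe] -/
theorem isPadicallyAutomorphic_iff (𝒰 : TameLevel n F p) (ρ : FramedGaloisRep F A n) :
    𝒰.IsPadicallyAutomorphic ρ ↔
      ∃ x : CompletedCohomologyHeckeAlgebraGLn 𝒰 →+* A, Continuous x ∧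
        ∀ v ∉ 𝒰.bad, ρ.IsUnramifiedAt v ∧
          ρ.HasFrobCharpolyAt v
            (heckeFrobPoly n (Ideal.absNorm v.asIdeal) fun i => x (𝒰.heckeT v i)) :=
  Iff.rfl

/-- The rank-two Hecke–Frobenius polynomial is `X² − a₁ X + q a₂` (so association at `v` reads
`tr ρ(Frob_v) = x(T_{v,1})`, `det ρ(Frob_v) = q_v · x(T_{v,2})`). [folklore] -/
theorem heckeFrobPoly_two {R : Type*} [CommRing R] (q : ℕ) (a : ℕ → R) :
    heckeFrobPoly 2 q a = X ^ 2 - C (a 1) * X + C ((q : R) * a 2) := by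
  have h : Finset.Icc 1 2 = {1, 2} := by decide
  rw [heckeFrobPoly, h, Finset.sum_insert (by decide), Finset.sum_singleton]
  norm_num
  abel

/-! ### §2 LOAD-BEARING: the conclusion forces almost-everywhere unramifiedness -/

/-- A place where `ρ` ramifies is a bad place of ANY tame level at which `ρ` is `p`-adically
automorphic (`bad ⊇` ramification set). [folklore] -/
theorem bad_of_not_isUnramifiedAt (𝒰 : TameLevel n F p) (ρ : FramedGaloisRep F A n)
    (h : 𝒰.IsPadicallyAutomorphic ρ) {v : HeightOneSpectrum (𝓞 F)}
    (hv : ¬ ρ.IsUnramifiedAt v) : v ∈ 𝒰.bad := by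
  obtain ⟨x, -, hx⟩ := h
  by_contra hvb
  exact hv (hx v hvb).1

/-- **The hypothesis `∀ᶠ v in cofinite, ρ.IsUnramifiedAt v` of the crux is implied by its
conclusion** (`bad` is finite): any proof may use it for free, and DROPPING it changes the
statement exactly by the class of infinitely ramified admissible `ρ` (`withoutAEUnramified_iff`).
[folklore] -/
theorem ae_isUnramifiedAt_of_isPadicallyAutomorphic (𝒰 : TameLevel n F p)
    (ρ : FramedGaloisRep F A n) (h : 𝒰.IsPadicallyAutomorphic ρ) :
    ∀ᶠ v in cofinite, ρ.IsUnramifiedAt v := by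
  rw [Filter.eventually_cofinite]
  exact 𝒰.bad_finite.subset fun v hv => bad_of_not_isUnramifiedAt 𝒰 ρ h hv

/-! ### §3 REFUTED STRENGTHENING (conditional): the level cannot be the full level -/

/-- At the full tame level `GL_n(𝒪̂_F)` (`bad = {v ∣ p}`) NO `ρ` ramified at a place `v ∤ p` is
`p`-adically automorphic: the natural strengthening "`𝒰 := TameLevel.full`" of the crux is false as
soon as one admissible `ρ` ramifies away from `p` (the route's witness `T₅(11a1)|Γ_{ℚ(√-2)}` does,
at `v ∣ 11`).  Hence both freedoms in `∃ 𝒰` — the set `bad` and the depth of `U` at `bad` — are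
used. [folklore] -/
theorem not_isPadicallyAutomorphic_full (ρ : FramedGaloisRep F A n) {v : HeightOneSpectrum (𝓞 F)}
    (hv : (p : 𝓞 F) ∉ v.asIdeal) (hram : ¬ ρ.IsUnramifiedAt v) :
    ¬ (TameLevel.full n F p).IsPadicallyAutomorphic ρ := fun h =>
  hv (bad_of_not_isUnramifiedAt (TameLevel.full n F p) ρ h hram)

end Conclusion

/-! ### §4 The crux as a sector of the pro-modularity expectation; the `hunr`-drop -/

/-- **Pro-modularity expectation for `GL₂` over `F` at `p`** (NOT asserted; a `Prop` used only as a
hypothesis): every continuous irreducible `ρ : Γ_F → GL₂(ℚ̄_p)` unramified almost everywhere is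
`p`-adically automorphic of some tame level.  This is the `GL₂`/imaginary-quadratic instance of the
big-`R = 𝕋` / completed-cohomology conjectures (Calegari–Emerton; Hansen 2017 §1.2; Gee–Newton
§3.3), with the residual pro-modularity of `ρ̄` left implicit (for residually reducible `ρ̄` it is
supplied by Eisenstein systems). -/
def ProModularityGL2 (F : Type) [Field F] [NumberField F] (p : ℕ) [Fact p.Prime] : Prop :=
  ∀ ρ : FramedGaloisRep F (PadicAlgCl p) 2, ρ.toGaloisRep.IsIrreducible →
    (∀ᶠ v in cofinite, ρ.IsUnramifiedAt v) → ∃ 𝒰 : TameLevel 2 F p, 𝒰.IsPadicallyAutomorphic ρ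

/-- **Why no `_false_without_H` exists for `H ∈ {p ≠ 2, O pinned, integral model, p-distinguished,
orientation, ordinarity, k ≥ 2}`:** the crux follows from `ProModularityGL2` using ONLY
irreducibility and a.e.-unramifiedness; every other hypothesis is surplus for truth (it is there for
the Skinner–Wiles METHOD).  A refutation of the crux, or of any of those weakenings, refutes
`ProModularityGL2 F p` for some imaginary quadratic `F` and odd `p`. [folklore] -/
theorem crux_of_proModularity
    (h : ∀ (F : Type) [Field F] [NumberField F] (p : ℕ) [Fact p.Prime], ProModularityGL2 F p) :
    ReducibleOrdinaryProModular := by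
  intro F _ _ _ _ p _ _ O _ ρ ρ₀ hirr hunr _ _
  exact h F p ρ hirr hunr

/-- The crux's hypotheses on `(F, p, O, ρ, ρ₀)` OTHER than a.e.-unramifiedness, bundled. -/
def Admissible (F : Type) [Field F] [NumberField F] (p : ℕ) [Fact p.Prime]
    (O : ValuationSubring (PadicAlgCl p)) (ρ : FramedGaloisRep F (PadicAlgCl p) 2)
    (ρ₀ : Field.absoluteGaloisGroup F →* Matrix.GeneralLinearGroup (Fin 2) O) : Prop :=
  NumberField.IsTotallyComplex F ∧ Module.finrank ℚ F = 2 ∧ p ≠ 2 ∧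
    O = (Valued.v : Valuation (PadicAlgCl p) NNReal).valuationSubring ∧
    ρ.toGaloisRep.IsIrreducible ∧ ρ.HasUpperTriangularIntegralModel ρ₀ ∧
    ∃ k : ℕ, 2 ≤ k ∧ ∃ m : ℕ, 0 < m ∧
      ∀ v : HeightOneSpectrum (𝓞 F), (p : 𝓞 F) ∈ v.asIdeal →
        IsPDistinguishedAt ρ₀ v ∧
        ∃ Q : Matrix.GeneralLinearGroup (Fin 2) (PadicAlgCl p),
          Valued.v (Q.val 0 0) ≤ Valued.v (Q.val 1 0) ∧
          ∀ σ, (Q⁻¹ * ρ.toLocal v σ * Q).val 1 0 = 0 ∧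
            (σ ∈ absInertia (v.adicCompletion F) →
              (Q⁻¹ * ρ.toLocal v σ * Q).val 1 1 ^ m = 1 ∧
              (Q⁻¹ * ρ.toLocal v σ * Q).val 0 0 ^ m =
                algebraMap (Padic p) (PadicAlgCl p)
                  (((GaloisRep.cyclotomicCharacter (v.adicCompletion F) p σ).val :
                    PadicInt p) : Padic p) ^ ((k - 1) * m))

/-- The crux in bundled form: `Admissible → a.e. unramified → ∃ 𝒰, p-adically automorphic`.
[probe] -/
theorem crux_iff_admissible :
    ReducibleOrdinaryProModular ↔
      ∀ (F : Type) [Field F] [NumberField F] (p : ℕ) [Fact p.Prime]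
        (O : ValuationSubring (PadicAlgCl p)) (ρ : FramedGaloisRep F (PadicAlgCl p) 2)
        (ρ₀ : Field.absoluteGaloisGroup F →* Matrix.GeneralLinearGroup (Fin 2) O),
        Admissible F p O ρ ρ₀ → (∀ᶠ v in cofinite, ρ.IsUnramifiedAt v) →
          ∃ 𝒰 : TameLevel 2 F p, 𝒰.IsPadicallyAutomorphic ρ := by
  constructor
  · rintro h F _ _ p _ O ρ ρ₀ ⟨hF, hdeg, hp, hO, hirr, hmod, hloc⟩ hunr
    exact h F hF hdeg p hp O hO ρ ρ₀ hirr hunr hmod hloc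
  · intro h F _ _ hF hdeg p _ hp O hO ρ ρ₀ hirr hunr hmod hloc
    exact h F p O ρ ρ₀ ⟨hF, hdeg, hp, hO, hirr, hmod, hloc⟩ hunr

/-- **`ReducibleOrdinaryProModular` with the hypothesis `hunr` (a.e. unramified) DROPPED.** -/
def WithoutAEUnramified : Prop :=
  ∀ (F : Type) [Field F] [NumberField F] (p : ℕ) [Fact p.Prime]
    (O : ValuationSubring (PadicAlgCl p)) (ρ : FramedGaloisRep F (PadicAlgCl p) 2)
    (ρ₀ : Field.absoluteGaloisGroup F →* Matrix.GeneralLinearGroup (Fin 2) O),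
    Admissible F p O ρ ρ₀ → ∃ 𝒰 : TameLevel 2 F p, 𝒰.IsPadicallyAutomorphic ρ

/-- "Every admissible `ρ` is unramified almost everywhere" — EXPECTED FALSE (infinitely ramified
`p`-adic Galois representations: Ramakrishna, *Infinitely ramified Galois representations*, Ann. of
Math. 151 (2000); a residually reducible ordinary analogue restricted from `ℚ` to `F` would be a
witness; not in print in exactly this shape and not constructible in Lean today). -/
def AdmissibleAEUnramified : Prop :=
  ∀ (F : Type) [Field F] [NumberField F] (p : ℕ) [Fact p.Prime]
    (O : ValuationSubring (PadicAlgCl p)) (ρ : FramedGaloisRep F (PadicAlgCl p) 2)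
    (ρ₀ : Field.absoluteGaloisGroup F →* Matrix.GeneralLinearGroup (Fin 2) O),
    Admissible F p O ρ ρ₀ → ∀ᶠ v in cofinite, ρ.IsUnramifiedAt v

/-- **Load-bearing status of `hunr`, exactly:** dropping a.e.-unramifiedness from the crux yields the
conjunction of the crux with `AdmissibleAEUnramified`.  So "any proof must use `hunr`" holds
precisely if an infinitely ramified admissible `ρ` exists (then `¬ WithoutAEUnramified` even granted
the crux), and conversely a proof of `WithoutAEUnramified` would prove that no such `ρ` exists.
[folklore] -/
theorem withoutAEUnramified_iff :
    WithoutAEUnramified ↔ ReducibleOrdinaryProModular ∧ AdmissibleAEUnramified := by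
  constructor
  · intro h
    refine ⟨crux_iff_admissible.2 fun F _ _ p _ O ρ ρ₀ hadm _ => h F p O ρ ρ₀ hadm, ?_⟩
    intro F _ _ p _ O ρ ρ₀ hadm
    obtain ⟨𝒰, h𝒰⟩ := h F p O ρ ρ₀ hadm
    exact ae_isUnramifiedAt_of_isPadicallyAutomorphic 𝒰 ρ h𝒰
  · rintro ⟨hcrux, hae⟩ F _ _ p _ O ρ ρ₀ hadm
    exact crux_iff_admissible.1 hcrux F p O ρ ρ₀ hadm (hae F p O ρ ρ₀ hadm)

/-- Corollary: given an infinitely ramified admissible witness, the `hunr`-dropped crux is FALSE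
(the `_false_without_` theorem, conditional on the witness). [folklore] -/
theorem withoutAEUnramified_false_of_witness
    (w : ∃ (F : Type) (_ : Field F) (_ : NumberField F) (p : ℕ) (_ : Fact p.Prime)
      (O : ValuationSubring (PadicAlgCl p)) (ρ : FramedGaloisRep F (PadicAlgCl p) 2)
      (ρ₀ : Field.absoluteGaloisGroup F →* Matrix.GeneralLinearGroup (Fin 2) O),
      Admissible F p O ρ ρ₀ ∧ ¬ ∀ᶠ v in cofinite, ρ.IsUnramifiedAt v) :
    ¬ WithoutAEUnramified := by
  rintro h
  obtain ⟨F, _, _, p, _, O, ρ, ρ₀, hadm, hram⟩ := w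
  exact hram ((withoutAEUnramified_iff.1 h).2 F p O ρ ρ₀ hadm)

/-! ### §5 The orientation clause `‖Q₀₀‖ ≤ ‖Q₁₀‖`: non-vacuous and genuinely restrictive -/

section Orientation

variable {p : ℕ} [Fact p.Prime]

/-- The swap frame `Q = (0 1; 1 0)` is oriented: the clause is satisfiable. [folklore] -/
theorem exists_orientedFrame :
    ∃ Q : Matrix.GeneralLinearGroup (Fin 2) (PadicAlgCl p),
      Valued.v (Q.val 0 0) ≤ Valued.v (Q.val 1 0) := by
  refine ⟨⟨!![0, 1; 1, 0], !![0, 1; 1, 0], ?_, ?_⟩, ?_⟩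
  · ext i j
    fin_cases i <;> fin_cases j <;> simp [Matrix.mul_apply, Fin.sum_univ_two]
  · ext i j
    fin_cases i <;> fin_cases j <;> simp [Matrix.mul_apply, Fin.sum_univ_two]
  · simp

/-- **A frame with vanishing lower-left entry is never oriented**: `Q₁₀ = 0` forces `Q₀₀ ≠ 0`
(invertibility), so `‖Q₀₀‖ > 0 = ‖Q₁₀‖`.  In particular the identity frame and every
upper-triangular frame — the ALIGNED orientation, ordinary line = global sub-line `e₀` — are
excluded by the crux, as intended (Skinner–Wiles transversality). [folklore] -/
theorem not_oriented_of_lowerLeft_eq_zero (Q : Matrix.GeneralLinearGroup (Fin 2) (PadicAlgCl p))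
    (h10 : Q.val 1 0 = 0) : ¬ Valued.v (Q.val 0 0) ≤ Valued.v (Q.val 1 0) := by
  intro hle
  rw [h10, map_zero, le_zero_iff, map_eq_zero] at hle
  have hdet : (Q : Matrix (Fin 2) (Fin 2) (PadicAlgCl p)).det = 0 := by
    rw [Matrix.det_fin_two]
    change Q.val 0 0 * Q.val 1 1 - Q.val 0 1 * Q.val 1 0 = 0
    rw [hle, h10, zero_mul, mul_zero, sub_zero]
  have hunit : IsUnit (Q : Matrix (Fin 2) (Fin 2) (PadicAlgCl p)).det :=
    (Matrix.isUnit_iff_isUnit_det _).mp (Units.isUnit Q)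
  rw [hdet] at hunit
  exact not_isUnit_zero hunit

/-- The identity frame is not oriented. [folklore] -/
theorem not_oriented_one :
    ¬ Valued.v ((1 : Matrix.GeneralLinearGroup (Fin 2) (PadicAlgCl p)).val 0 0) ≤
        Valued.v ((1 : Matrix.GeneralLinearGroup (Fin 2) (PadicAlgCl p)).val 1 0) :=
  not_oriented_of_lowerLeft_eq_zero 1 (by simp)

/-- An oriented frame has `Q₁₀ ≠ 0` (tightness of the clause: it pins the ordinary line away from
`e₀`). [folklore] -/
theorem oriented_lowerLeft_ne_zero (Q : Matrix.GeneralLinearGroup (Fin 2) (PadicAlgCl p))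
    (h : Valued.v (Q.val 0 0) ≤ Valued.v (Q.val 1 0)) : Q.val 1 0 ≠ 0 := fun h10 =>
  not_oriented_of_lowerLeft_eq_zero Q h10 h

end Orientation

/-! ### §6 Surplus of the local clause over plain ordinarity (what `closes` discards) -/

/-- The crux's local clause at `v` implies `IsOrdinaryOfWeightAt p ρ v k m` (orientation and
`p`-distinguishedness dropped) — exactly the step used by the route's `closes`; recorded so that
line authors see the precise surplus `IsPDistinguishedAt ρ₀ v ∧ ‖Q₀₀‖ ≤ ‖Q₁₀‖`. [folklore] -/
theorem isOrdinaryOfWeightAt_of_localClause {F : Type} [Field F] [NumberField F] (p : ℕ)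
    [Fact p.Prime] (ρ : FramedGaloisRep F (PadicAlgCl p) 2) (v : HeightOneSpectrum (𝓞 F))
    (k m : ℕ)
    (h : ∃ Q : Matrix.GeneralLinearGroup (Fin 2) (PadicAlgCl p),
      Valued.v (Q.val 0 0) ≤ Valued.v (Q.val 1 0) ∧
      ∀ σ, (Q⁻¹ * ρ.toLocal v σ * Q).val 1 0 = 0 ∧
        (σ ∈ absInertia (v.adicCompletion F) →
          (Q⁻¹ * ρ.toLocal v σ * Q).val 1 1 ^ m = 1 ∧
          (Q⁻¹ * ρ.toLocal v σ * Q).val 0 0 ^ m =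
            algebraMap (Padic p) (PadicAlgCl p)
              (((GaloisRep.cyclotomicCharacter (v.adicCompletion F) p σ).val : PadicInt p) :
                Padic p) ^ ((k - 1) * m))) :
    FramedGaloisRep.IsOrdinaryOfWeightAt p ρ v k m := by
  obtain ⟨Q, -, hQ⟩ := h
  exact (FramedGaloisRep.isOrdinaryOfWeightAt_iff_padicAlgCl p ρ v k m).mpr ⟨Q, hQ⟩

/-! ### §7 Robustness of the conclusion: `bad` may be enlarged at will

With `bad_of_not_isUnramifiedAt` (§2) this gives: WLOG `𝒰.bad` is ANY finite set containing the
ramification set of `ρ` and the places above `p` — no refutation can exploit the shape of `bad`,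
and provers may fix `bad` generously before choosing the depth of `U` at the bad places. -/

section EnlargeBad

variable {n : ℕ} {F : Type} [Field F] [NumberField F] {p : ℕ} [Fact p.Prime]
variable {A : Type*} [CommRing A] [TopologicalSpace A]

/-- The same level subgroup `U` with a LARGER finite bad set `T ⊇ 𝒰.bad` is again an `S`-good tame
level (hyperspeciality and factorizability are asked at fewer places). [folklore] -/
def enlargeBad (𝒰 : TameLevel n F p) (T : Set (HeightOneSpectrum (𝓞 F))) (hT : T.Finite)
    (hle : 𝒰.bad ⊆ T) : TameLevel n F p where
  subgroup := 𝒰.subgroup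
  bad := T
  bad_finite := hT
  mem_bad_of_mem v hv := hle (𝒰.mem_bad_of_mem v hv)
  isOpen := 𝒰.isOpen
  isCompact := 𝒰.isCompact
  le_glFiniteIntegralLevel := 𝒰.le_glFiniteIntegralLevel
  ofLocal_mem v hv g hg := 𝒰.ofLocal_mem v (fun h => hv (hle h)) g hg
  mul_ofLocal_inv_mem v hv u hu := 𝒰.mul_ofLocal_inv_mem v (fun h => hv (hle h)) u hu

variable (𝒰 : TameLevel n F p) (T : Set (HeightOneSpectrum (𝓞 F))) (hT : T.Finite)
  (hle : 𝒰.bad ⊆ T)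

/-- Same tower, same Hecke operators. [folklore] -/
theorem heckeOperator_enlargeBad (g : FiniteAdelicGL n F) :
    (enlargeBad 𝒰 T hT hle).heckeOperator g = 𝒰.heckeOperator g := rfl

/-- Fewer good places, fewer generators. [folklore] -/
theorem heckeGenerators_enlargeBad_subset :
    (enlargeBad 𝒰 T hT hle).heckeGenerators ⊆ 𝒰.heckeGenerators := by
  rintro x (⟨v, hv, i, rfl⟩ | ⟨v, hv, rfl⟩)
  · exact Or.inl ⟨v, fun h => hv (hle h), i, rfl⟩
  · exact Or.inr ⟨v, fun h => hv (hle h), rfl⟩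

/-- `𝕋(U, T) ⊆ 𝕋(U, bad)` inside the common product ring. [folklore] -/
theorem bigHeckeSubring_enlargeBad_le :
    (enlargeBad 𝒰 T hT hle).bigHeckeSubring ≤ 𝒰.bigHeckeSubring :=
  Subring.topologicalClosure_mono
    (Subring.closure_mono (heckeGenerators_enlargeBad_subset 𝒰 T hT hle))

/-- **`p`-adic automorphy is upward closed in `bad`**: restrict the point `x` along
`𝕋(U, T) ⊆ 𝕋(U, bad)`. [folklore] -/
theorem isPadicallyAutomorphic_enlargeBad (ρ : FramedGaloisRep F A n)
    (h : 𝒰.IsPadicallyAutomorphic ρ) : (enlargeBad 𝒰 T hT hle).IsPadicallyAutomorphic ρ := by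
  obtain ⟨x, hx, hass⟩ := h
  have hsub := bigHeckeSubring_enlargeBad_le 𝒰 T hT hle
  have hcont : Continuous (Subring.inclusion hsub) := by
    refine continuous_induced_rng.2 ?_
    have hval : Continuous (Subtype.val :
        (enlargeBad 𝒰 T hT hle).bigHeckeSubring → (enlargeBad 𝒰 T hT hle).bigEnd) :=
      continuous_subtype_val
    convert hval using 1
    funext y
    exact Subring.coe_inclusion hsub y
  refine ⟨x.comp (Subring.inclusion hsub), hx.comp hcont, fun v hv => ?_⟩
  have hvb : v ∉ 𝒰.bad := fun h => hv (hle h)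
  obtain ⟨hunr, hchar⟩ := hass v hvb
  refine ⟨hunr, ?_⟩
  have key : ∀ i, x (Subring.inclusion hsub ((enlargeBad 𝒰 T hT hle).heckeT v i)) =
      x (𝒰.heckeT v i) := by
    intro i
    congr 1
    apply Subtype.ext
    rw [Subring.coe_inclusion, (enlargeBad 𝒰 T hT hle).coe_heckeT hv i, 𝒰.coe_heckeT hvb i]
    rfl
  have e : (fun i => (x.comp (Subring.inclusion hsub)) ((enlargeBad 𝒰 T hT hle).heckeT v i)) =
      fun i => x (𝒰.heckeT v i) := funext key
  convert hchar using 3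
  exact e

include hT hle in
/-- Corollary used in the analysis: if `ρ` is `p`-adically automorphic of level `𝒰`, it is so of a
level whose bad set is any prescribed finite `T ⊇ 𝒰.bad`. [folklore] -/
theorem exists_isPadicallyAutomorphic_bad_eq (ρ : FramedGaloisRep F A n)
    (h : 𝒰.IsPadicallyAutomorphic ρ) :
    ∃ 𝒰' : TameLevel n F p, 𝒰'.bad = T ∧ 𝒰'.IsPadicallyAutomorphic ρ :=
  ⟨enlargeBad 𝒰 T hT hle, rfl, isPadicallyAutomorphic_enlargeBad 𝒰 T hT hle ρ h⟩

end EnlargeBad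

end

end Summit.Langlands.Langlands.Cruxes.ReducibleOrdinaryProModular.Disproof
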